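import Summits.ABC.IUTFork.Cor312Statement
import Summits.ABC.IUTFork.Thm311Real2
import HarnessLib

/-!
# [IUTchIII] Corollary 3.12, statement — HULL-SET LOCALITY: the typed statement reads the mono-analytic log-volume of
# Thm. 3.11 (i) (a) ONLY on the hull-sets `λ·𝒪_L` of its frames, and nothing else of the line data

PROOF-ONLY record file (D-0012) of the abc-iut cell (Cor. 3.12 sub-crew, seat abc-iut-c312-6, gen 5; TEAM B real-setting
lane); TAKES NO SIDE; 0 `def`s, 0 `Prop` facts. The GENERIC form of the container-robustness theorems of this seat's
`Cor312SettingDHFramesRobust` (p424766: verbatim summandwise `𝕄(−)` vs field-boxes at the Dupuy–Hilado real setting) and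
`Cor312FrameVolumePiecesDHArch` (archimedean place honest).

Let `L` be ANY log-shell signature (c312-1 `Thm311.LogShells`) and let `S₁ = Situation.ofShells L M₁ …₁`,
`S₂ = Situation.ofShells L M₂ …₂` be two situations of Thm. 3.11 built on `L` (c312-5's constructor, `Thm311Real2`) with
ARBITRARY, POSSIBLY DIFFERENT data (a)(b)(c): archimedean integral structures `archPk`/`archSub`, admissible regions `Adm`,
log-volumes `logvol`, splitting monoids `Ψ`/`act`, number fields `M_mod`, global realified Frobenioids (`M`, `region`).
Let `P₁ : Cor312.Setting S₁`, `P₂ : Cor312.Setting S₂` be two typed settings of the Corollary (c312-7 `Cor312.Setting`,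
FROZEN) with

* the same hull frames (`hframe : ∀ j v_ℚ, P₁.frame j v_ℚ = P₂.frame j v_ℚ`),
* the same (Ind3)-enlarged Θ-pilot regions (`hθ : ∀ j v_ℚ, P₁.thetaRegion3 j v_ℚ = P₂.thetaRegion3 j v_ℚ`) and the same
  `q`-pilot regions (`hqR`),
* log-volumes that AGREE ON THE HULL-SETS OF THE FRAMES
  (`hagree : ∀ j v_ℚ, ∀ H ∈ (P₁.frame j v_ℚ).Hul, logvol₁ j v_ℚ H = logvol₂ j v_ℚ H`).

Then (§2) `P₁` and `P₂` have the same possible images of the Θ-pilot object, the same hulls `^{n,∘}𝒰_{j,v_ℚ}`, the same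
`HullDefined`, the same `qLocal`, `thetaLocal`, `ThetaFinite`, `−|log(Θ)|`, `−|log(q)|`, and
**`statement_iff_of_agree : P₁.Statement ↔ P₂.Statement`**. In words: of the data (a)(b)(c) of [IUTchIII] Thm. 3.11 (i)
that the typed Cor. 3.12 is stated over, the printed statement (p. 174 l. 16–18) consumes — besides the frames, the two
pilot regions and the common (Ind1),(Ind2)-group of `L` — ONLY the values of the log-volume of (a) on hull-sets
`λ·𝒪_L` ([IUTchIII] Rmk. 3.9.5 (i)(ii) p. 127: `λ·𝒪 ∈ 𝕄(𝓘^ℚ(−))`); admissibility `𝕄(−)` itself enters only through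
the well-formedness field `hul_adm` of the settings, and (b), (c), the archimedean integral structures and the global
Frobenioids not at all. Corollaries of record: p424766's `statement_settingDHFrames_iff` and the archimedean-honest twin
are the instances "verbatim summandwise `𝕄(−)` vs boxes over the field factors"; any further container (print-normalised
weights, other archimedean conventions) with the same hull-set values gives the same typed Cor. 3.12.
§1 records the line-independence used: for `Situation.ofShells` the container of line `n` is `logvol` for every `n`.
Everything here is bookkeeping over c312-7's FROZEN `Cor312Statement`; nothing asserts or denies [IUTchIII] Cor. 3.12
or takes a side; typed ≠ proved. [claim: Mochizuki2012, status: disputed] for the quoted statement.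
-/

noncomputable section

open Set Function

namespace Summit.ABC

namespace IUTFork

namespace Cor312

namespace HullSetLocality

open Thm311 Setting Literature.IUT.LogThetaLattice Literature.IUT.LogVolume

variable {T : ThetaIndex} {L : LogShells T}
  {M₁ : Type} [Field M₁] [NumberField M₁] {M₂ : Type} [Field M₂] [NumberField M₂]
  {archPk₁ archPk₂ : ∀ (j : T.Label) (vQ : T.VQ), Set (L.Packet j vQ)}
  {archSub₁ archSub₂ : ∀ (j : T.Label) (v : T.V), Set (L.Packet j (T.over v))}
  {Adm₁ Adm₂ : ∀ (j : T.Label) (vQ : T.VQ), Set (L.Packet j vQ) → Prop}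
  {logvol₁ logvol₂ : ∀ (j : T.Label) (vQ : T.VQ), Set (L.Packet j vQ) → ℝ}
  {Ψ₁ Ψ₂ : ℤ → ∀ v : T.V, v ∈ T.Vbad → Set (L.StarPacket v)}
  {act₁ act₂ : ℤ → ∀ v : T.V, v ∈ T.Vbad → L.StarPacket v → Module.End ℚ (L.StarPacket v)}
  {Mmod₁ Mmod₂ : ℤ → ∀ j : T.LabelStar, Set (L.GlobalPacket j.1)}
  {region₁ : ℤ → ∀ j : T.LabelStar, FinDivisor M₁ → ∀ vQ : T.VQ, Set (L.Packet j.1 vQ)}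
  {region₂ : ℤ → ∀ j : T.LabelStar, FinDivisor M₂ → ∀ vQ : T.VQ, Set (L.Packet j.1 vQ)}
  (P₁ : Setting (Situation.ofShells L M₁ archPk₁ archSub₁ Adm₁ logvol₁ Ψ₁ act₁ Mmod₁ region₁))
  (P₂ : Setting (Situation.ofShells L M₂ archPk₂ archSub₂ Adm₂ logvol₂ Ψ₂ act₂ Mmod₂ region₂))

/-! ## §1. What a setting over `Situation.ofShells` reads from the line data -/

/-- Over `Situation.ofShells`, the local `q`-volume of ANY setting is `logvol` of its `q`-region (the container is the
same on every line `n`). [folklore] -/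
theorem qLocal_eq_logvol (j : T.Label) (vQ : T.VQ) : P₁.qLocal j vQ = logvol₁ j vQ (P₁.qRegion j vQ) := rfl

open scoped Classical in
/-- Over `Situation.ofShells`, the local `−|log(Θ)|` of ANY setting is `logvol` of the hull `^{n,∘}𝒰_{j,v_ℚ}` when that
hull is defined, `+∞` otherwise. [folklore] -/
theorem thetaLocal_eq_ite (j : T.Label) (vQ : T.VQ) :
    P₁.thetaLocal j vQ = if P₁.HullDefined j vQ then ((logvol₁ j vQ (P₁.thetaHull j vQ) : ℝ) : WithTop ℝ) else ⊤ :=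
  rfl

/-- The `q`-pilot region is a hull-set of the frame (the setting's field `qRegion_mem`). [folklore] -/
theorem qRegion_mem_hul (j : T.Label) (vQ : T.VQ) : P₁.qRegion j vQ ∈ (P₁.frame j vQ).Hul := P₁.qRegion_mem j vQ

/-- Under `HullDefined` the hull `^{n,∘}𝒰_{j,v_ℚ}` is a hull-set of the frame (`HullFrame.hull_mem_of_hasHull`).
[folklore] -/
theorem thetaHull_mem_hul {j : T.Label} {vQ : T.VQ} (h : P₁.HullDefined j vQ) :
    P₁.thetaHull j vQ ∈ (P₁.frame j vQ).Hul :=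
  (P₁.frame j vQ).hull_mem_of_hasHull h.1 h.2

/-! ## §2. Two settings with the same frames and pilot regions whose log-volumes agree on hull-sets -/

section Agree

variable {P₁ P₂}
  (hframe : ∀ (j : T.Label) (vQ : T.VQ), P₁.frame j vQ = P₂.frame j vQ)
  (hθ : ∀ (j : T.Label) (vQ : T.VQ), P₁.thetaRegion3 j vQ = P₂.thetaRegion3 j vQ)
  (hqR : ∀ (j : T.Label) (vQ : T.VQ), P₁.qRegion j vQ = P₂.qRegion j vQ)
  (hagree : ∀ (j : T.Label) (vQ : T.VQ), ∀ H ∈ (P₁.frame j vQ).Hul, logvol₁ j vQ H = logvol₂ j vQ H)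

include hθ in
/-- Same (Ind3)-regions ⟹ same possible images of the Θ-pilot object (the (Ind1),(Ind2)-group is that of the common
`L`). [folklore] -/
theorem possibleImages_eq (j : T.Label) (vQ : T.VQ) : P₁.possibleImages j vQ = P₂.possibleImages j vQ := by
  unfold Setting.possibleImages
  rw [hθ j vQ]
  rfl

include hframe hθ in
/-- … and, with the same frames, the same hull `^{n,∘}𝒰_{j,v_ℚ}`. [folklore] -/
theorem thetaHull_eq (j : T.Label) (vQ : T.VQ) : P₁.thetaHull j vQ = P₂.thetaHull j vQ := by
  unfold Setting.thetaHull
  rw [hframe j vQ, possibleImages_eq hθ j vQ]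
  rfl

include hframe hθ in
/-- … and the same `HullDefined`. [folklore] -/
theorem hullDefined_iff (j : T.Label) (vQ : T.VQ) : P₁.HullDefined j vQ ↔ P₂.HullDefined j vQ := by
  unfold Setting.HullDefined
  rw [hframe j vQ, possibleImages_eq hθ j vQ]
  exact Iff.rfl

include hqR hagree in
/-- **Same local `q`-volume**: the `q`-region is a hull-set of the frame, where the two log-volumes agree.
[claim: Mochizuki2012, status: disputed] -/
theorem qLocal_eq (j : T.Label) (vQ : T.VQ) : P₁.qLocal j vQ = P₂.qLocal j vQ := by
  rw [qLocal_eq_logvol P₁, qLocal_eq_logvol P₂, ← hqR j vQ]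
  exact hagree j vQ _ (qRegion_mem_hul P₁ j vQ)

include hframe hθ hagree in
/-- **Same local `−|log(Θ)|`**: when defined, the hull is a hull-set of the (common) frame, where the two log-volumes
agree; otherwise both read `+∞`. [claim: Mochizuki2012, status: disputed] -/
theorem thetaLocal_eq (j : T.Label) (vQ : T.VQ) : P₁.thetaLocal j vQ = P₂.thetaLocal j vQ := by
  rw [thetaLocal_eq_ite P₁, thetaLocal_eq_ite P₂]
  by_cases h : P₁.HullDefined j vQ
  · rw [if_pos h, if_pos ((hullDefined_iff hframe hθ j vQ).mp h), ← thetaHull_eq hframe hθ j vQ,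
      hagree j vQ _ (thetaHull_mem_hul P₁ h)]
  · rw [if_neg h, if_neg (mt (hullDefined_iff hframe hθ j vQ).mpr h)]

include hframe hθ hagree in
/-- **Same `ThetaFinite`** ("`−|log(Θ)| ∈ ℝ`"). [claim: Mochizuki2012, status: disputed] -/
theorem thetaFinite_iff : P₁.ThetaFinite ↔ P₂.ThetaFinite := by
  simp only [Setting.ThetaFinite, thetaLocal_eq hframe hθ hagree]

include hframe hθ hagree in
/-- **Same `−|log(Θ)|`.** [claim: Mochizuki2012, status: disputed] -/
theorem negLogTheta_eq : P₁.negLogTheta = P₂.negLogTheta := by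
  unfold Setting.negLogTheta
  by_cases h : P₂.ThetaFinite
  · rw [if_pos ((thetaFinite_iff hframe hθ hagree).mpr h), if_pos h]
    simp only [thetaLocal_eq hframe hθ hagree]
  · rw [if_neg (mt (thetaFinite_iff hframe hθ hagree).mp h), if_neg h]

include hqR hagree in
/-- **Same `−|log(q)|`.** [claim: Mochizuki2012, status: disputed] -/
theorem negLogQ_eq : P₁.negLogQ = P₂.negLogQ := by
  unfold Setting.negLogQ
  simp only [qLocal_eq hqR hagree]

include hframe hθ hqR hagree in
/-- **HULL-SET LOCALITY OF THE TYPED COROLLARY 3.12.** Two typed settings of [IUTchIII] Cor. 3.12 over situations built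
on the SAME log-shell signature — with arbitrary, possibly different archimedean integral structures, admissible
regions `𝕄(−)`, log-volumes, splitting monoids, number fields and global realified Frobenioids — that have the same
hull frames, the same (Ind3)-Θ-regions and `q`-regions, and whose log-volumes AGREE ON THE HULL-SETS `λ·𝒪_L` of the
frames, satisfy the printed statement "`−|log(Θ)| ∈ ℝ` and `−|log(Θ)| ≥ −|log(q)|`" (p. 174 l. 16–18, c312-7
`Cor312.Setting.Statement`) SIMULTANEOUSLY. Neither side is asserted. [claim: Mochizuki2012, status: disputed] -/
theorem statement_iff_of_agree : P₁.Statement ↔ P₂.Statement := by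
  unfold Setting.Statement
  rw [negLogTheta_eq hframe hθ hagree, negLogQ_eq hqR hagree]

include hframe hθ hqR hagree in
/-- The same for the printed `C_Θ`-form (p. 174 l. 18–19). [claim: Mochizuki2012, status: disputed] -/
theorem cThetaForm_iff_of_agree : P₁.CThetaForm ↔ P₂.CThetaForm := by
  unfold Setting.CThetaForm Setting.absLogQ
  rw [negLogTheta_eq hframe hθ hagree, negLogQ_eq hqR hagree]

end Agree

/-! ## §3. The special case of ONE situation: the statement does not depend on the column's other data -/

/-- Two settings over the SAME situation `Situation.ofShells L …` with the same frames and pilot regions have the same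
typed Cor. 3.12 — whatever their columns `n`, lattices, Prop-3.7 outputs, splitting-monoid and `q`-pilot DATA are
(only the resulting REGIONS matter). [claim: Mochizuki2012, status: disputed] -/
theorem statement_iff_of_regions_eq
    (P P' : Setting (Situation.ofShells L M₁ archPk₁ archSub₁ Adm₁ logvol₁ Ψ₁ act₁ Mmod₁ region₁))
    (hframe : ∀ (j : T.Label) (vQ : T.VQ), P.frame j vQ = P'.frame j vQ)
    (hθ : ∀ (j : T.Label) (vQ : T.VQ), P.thetaRegion3 j vQ = P'.thetaRegion3 j vQ)
    (hqR : ∀ (j : T.Label) (vQ : T.VQ), P.qRegion j vQ = P'.qRegion j vQ) :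
    P.Statement ↔ P'.Statement :=
  statement_iff_of_agree hframe hθ hqR fun _ _ _ _ => rfl

end HullSetLocality

end Cor312

end IUTFork

end Summit.ABC

end
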